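import Summits.PneNP.PneNP.Theorems.RegularResolutionRung.Negative.EmptyGraphLines

/-!
# Route RamseyUncertifiable, crux `RegularResolutionRung` (stmt-PneNP-9818): vocabulary of the line
`indelible-zero-banks` (definitions)

Objects posited by the line `indelible-zero-banks` for the crux
`Summit.PneNP.PneNP.Theses.RamseyUncertifiable.RegularResolutionRung` (skeleton
`Summits/PneNP/PneNP/Cruxes/RegularResolutionRung/Lines/indelible-zero-banks.lean`, whose registered stubs
`stub_restrict`, `stub_oneWidthNF`, `stub_bankEntropy` are stated in exactly this vocabulary and namespace), all over
a Bool adjacency `adj : Fin m → Fin m → Bool` and the landed `Negative.cliqueCNF`: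

* `edgeCount adj A B` — ordered pair count (LPRT arXiv:1303.3166 Def. 10, ordered version);
* `LowerDense` / `UpperDense` / `BiDense adj M δ` — two-sided Prömel–Rödl bi-density at scale `M`;
* `negSupport n k C` — the vertices `v` with some `¬x_{i,v}` (`i < k`) in the clause `C` (its cardinality is the
  ONE-WIDTH of `C`; Atserias et al. arXiv:2012.09476 §6, `⋃_i V¹_i(c)`).

Definitions only; no fact is asserted (the SimpleGraph-form vocabulary of the sibling infrastructure lives in
`RamseyUncertifiableRegularResolutionRungDefs.lean`). [folklore]
-/

noncomputable section

open scoped Classical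

namespace Summit.PneNP.PneNP.Cruxes.RegularResolutionRung.IndelibleZeroBanks

open Finset
open Literature.Computability.MetaComplexity Literature.Computability.Complexity

set_option linter.dupNamespace false -- `Summit.PneNP.PneNP.…`: summit = sub-problem name (single-conjunct summit, D-0017)

variable {m : ℕ}

/-- Ordered pair count `e(A,B) = #{(a,b) ∈ A × B : adj a b}` (LPRT Def. 10, ordered version; for
symmetric irreflexive `adj` and `A = B` every edge is counted twice and the diagonal never). [folklore] -/
def edgeCount (adj : Fin m → Fin m → Bool) (A B : Finset (Fin m)) : ℕ :=
  ((A ×ˢ B).filter fun p => adj p.1 p.2 = true).card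

/-- Lower bi-density at scale `M`: `δ|A||B| ≤ e(A,B)` whenever `|A|,|B| ≥ M` (the Prömel–Rödl half
used by LPRT). [folklore] -/
def LowerDense (adj : Fin m → Fin m → Bool) (M : ℕ) (δ : ℝ) : Prop :=
  ∀ A B : Finset (Fin m), M ≤ A.card → M ≤ B.card → δ * A.card * B.card ≤ (edgeCount adj A B : ℝ)

/-- Upper bi-density at scale `M`: `e(A,B) ≤ (1-δ)|A||B|` whenever `|A|,|B| ≥ M` (the Prömel–Rödl
half LPRT discard — "we will only use the lower bound", arXiv:1303.3166 p. 9; the engine of this line: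
it is what excludes the complete `(k-1)`-partite graph and the join family of TRIAGE r1-1 §A). [folklore] -/
def UpperDense (adj : Fin m → Fin m → Bool) (M : ℕ) (δ : ℝ) : Prop :=
  ∀ A B : Finset (Fin m), M ≤ A.card → M ≤ B.card →
    (edgeCount adj A B : ℝ) ≤ (1 - δ) * A.card * B.card

/-- Two-sided bi-density at scale `M` with density `δ`. Monotone in `M` (fewer pairs to check at
larger scales); unsatisfiable at scales `M ≤ 1` for `m ≥ 1`, `δ > 0` (take `A = B = {v}`), so the
log-form scale hypotheses below are never degenerate. [folklore] -/
def BiDense (adj : Fin m → Fin m → Bool) (M : ℕ) (δ : ℝ) : Prop :=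
  LowerDense adj M δ ∧ UpperDense adj M δ

/-- The NEGATIVE SUPPORT of a clause over the variables of `Clique(·,k)` on `n` vertices: the
vertices `v` such that some `¬x_{i,v}` (`i < k`) occurs in it — in branching-program language the
vertices with a REMEMBERED ONE at the node (ABdRLNR's `⋃_i V¹_i(c)`). Its cardinality is the
ONE-WIDTH of the clause. Junk variables `≥ k·n` (reachable only by weakening) do not count. [folklore] -/
def negSupport (n k : ℕ) (C : Finset (Literal ℕ)) : Finset (Fin n) :=
  Finset.univ.filter fun v => ∃ i < k, ((i * n + (v : ℕ), false) : Literal ℕ) ∈ C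

/-- Vocabulary anchor (registered sub-goal `banks_defs_anchor` of stmt-PneNP-9818): the one-width of the empty
clause is zero. -/
theorem banks_defs_anchor : ∀ (n k : ℕ), (negSupport n k (∅ : Finset (Literal ℕ))).card = 0 := by
  intro n k
  simp [negSupport]

end Summit.PneNP.PneNP.Cruxes.RegularResolutionRung.IndelibleZeroBanks

end
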